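import Literature.NumberTheory.EllipticCurves.CMTorsionGaloisImageHoldsProofs
import Literature.NumberTheory.EllipticCurves.PointDivisibilityProofs
import HarnessLib

/-!
# `E[p]` is irreducible for a CM elliptic curve over `ℚ` at a good ordinary prime `p > 3`

Topic `NumberTheory/EllipticCurves`; theorems only (no definition, no named fact, no instance;
D-0014/D-0026).  Serves the named fact
`Literature.NumberTheory.EllipticCurves.burungaleTian_analyticRank_eq_zero_of_selmerCorank_eq_zero_of_hasCM`
(`BSDSelmerCMPConverse.lean`; Burungale–Tian, Ann. of Math. 203 (2026), Thm. 1.1) through its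
sibling `BSDSelmerCMPConverseOrdinaryProofs`: the good-ordinary slice of that fact proved in
`BSDSelmerPConverseRankZeroProofs` carries the hypothesis `(irr_ℚ)` "`E[p]` is an irreducible
`Γ_ℚ`-module" of Mazur's main conjecture (Burungale–Castella–Skinner 2025, Thm. 1.1.2), and this
file discharges it for CM curves.

## Main statement

`WeierstrassCurve.hasIrreducibleModPGaloisRep_of_hasCM_of_not_dvd_frobeniusTrace`: let `E = W/ℚ`
be an elliptic curve in global minimal form with (geometric) complex multiplication, and `p > 3` a
prime of good reduction with `p ∤ a_p(E)` (good ORDINARY reduction).  Then `ρ̄_{E,p}` is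
irreducible: the only `Γ_ℚ`-stable subgroups of `E[p]` are `0` and `E[p]`.

This is a consequence of the classical description of the mod-`p` image of a CM curve (J.-P.
Serre, *Invent. Math.* 15 (1972), §4.5 with §1.11: for almost all `p` the image of `Γ_K`, `K` the
CM field, is the Cartan subgroup `(O/p)ˣ` and the image of `Γ_ℚ` is its normaliser; D. Zywina,
arXiv:1508.07660, Prop. 1.14 (`j ≠ 0`) and Prop. 1.16 (`j = 0`) for the precise list over `ℚ`),
read at an ordinary prime, where `p` splits in `K` and in particular `p ∤ disc O`: a line stable
under the Cartan subgroup is an eigenline of `√D`, and complex conjugation swaps the two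
eigenlines.  Reducibility does occur at the (supersingular) primes ramified in `K` (the rational
`p`-isogeny with kernel `E[√D] ∩ E[p]`), so the ordinary hypothesis cannot simply be dropped.

## Proof (all from theorems of the tree)

Let `ψ ∈ End_{ℚ̄}(E)` with `ψ² = D < 0` and its quadratic twisting character `χ ≠ 1`,
`ψ(σP) = χ(σ)·σψ(P)` (Lang's Remark; the tree's
`WeierstrassCurve.exists_sq_eq_intCast_quadraticTwist_of_hasCM`).

* §1–§2 **Making `√D` visible on `E[p]`.**  The given `D` is the discriminant of SOME CM
  endomorphism and may be divisible by `p²` (e.g. `ψ = p√-1`), in which case `ψ` vanishes on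
  `E[p]`.  Whenever `ψ|E[p] = 0`, `ψ` factors through the surjection `[p] : E(ℚ̄) → E(ℚ̄)`
  (Silverman *AEC* §VIII.2; the tree's `zsmul_geomPoints_surjective_holds`) as `ψ = ψ₁ ∘ [p]`
  with `ψ₁` additive, twisted by the same `χ`, and `ψ₁² = D/p²` (`D` kills `E[p²]`, so `p² ∣ D` by
  counting `#E[n] = n²`); `|D|` drops, so after finitely many steps `ψ|E[p] ≠ 0`
  (`exists_sqrt_twist_apply_ne_zero_of_hasCM`).  (This replaces *AEC* III.4.11 — an endomorphism
  killing `E[p]` is divisible by `p` in `End(E)` — which the tree does not have; `ψ₁` is not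
  claimed to be a geometric endomorphism, and none of the later steps needs it to be.)
* §3 **At a good ordinary `p > 3`, `p ∤ D`** (`not_dvd_of_sqrt_twist_of_not_dvd_frobeniusTrace`;
  Deuring's "ramified primes are supersingular", read on `E[p]`).  If `p ∣ D` then `φ = ψ|E[p]`
  is a non-zero endomorphism of the plane `E[p]` with `φ² = 0`, commuting or anti-commuting with
  every `ρ̄(σ)`.  By Serre §1.11 (Prop. 11 and Cor.; tree:
  `exists_line_of_not_dvd_frobeniusTrace`, `exists_mem_inertia_smul_eq_of_sub_mem_line`) the
  inertia group at `p` contains `τ` with `τ ≡ 1 mod 𝔽_p v₀` and `τ v₀ = 2 v₀`; since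
  `2 ∉ {0, 1, -1}` in `𝔽_p` (`p > 3`), the eigenvalues of `τ` are exactly `2` (on `𝔽_p v₀`) and `1`,
  and `±φ τ = τ φ` forces `φ v₀ = 0` and `φ w = 0` for every `τ`-fixed `w`, i.e. `φ = 0` —
  a contradiction.
* §4 **`p ∤ D` gives irreducibility** (`hasIrreducibleModPGaloisRep_of_sqrt_twist`).  By the
  tree's Cartan theorem `exists_smul_eq_add_mul_of_not_dvd_minimalDiscriminantInt` (Lang, Ch. 10
  §4 Thm. 8 = Serre §4.5, proved in `CMTorsionGaloisImageHoldsProofs`) some `σ ∈ Γ_K` acts on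
  `E[p]` exactly as `φ`; so a `Γ_ℚ`-stable line `L` is an eigenline of `φ`, `φ|_L = λ`,
  `λ² ≡ D ≢ 0`; applying `σ₀` with `χ(σ₀) = -1` (which preserves `L`) gives `λ ≡ -λ`, so
  `p ∣ λ` and `p ∣ D` — a contradiction.
* §5 Assembly.

## References

* [Serre1972] J.-P. Serre, *Propriétés galoisiennes des points d'ordre fini des courbes
  elliptiques*, Invent. Math. 15 (1972) 259–331: §1.11 (Prop. 11 and Cor.; Prop. 12), §4.5 (the
  CM case: Cartan image over the CM field, normaliser over `ℚ`).  Not held (acquisition request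
  filed 2026-08-17); cited through the tree files `CMTorsionGaloisImageHoldsProofs`,
  `SerreOpenImageOrdinaryInertiaProofs`, whose theorems are the only inputs used here.
* [Zywina2015] D. Zywina, *On the possible images of the mod ℓ representations associated to
  elliptic curves over ℚ*, arXiv:1508.07660, §1.9 (Prop. 1.14, Prop. 1.16) and §7 (Lemma 7.2),
  quoted in the tree file `ZywinaCMImage`.
* [Lang1987] S. Lang, *Elliptic Functions*, 2nd ed., GTM 112 (1987), Ch. 10 §4, Remark, Thm. 8.
* [SilvermanAEC2009] J. H. Silverman, *The Arithmetic of Elliptic Curves*, 2nd ed. (2009),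
  III.6.4(b), §VIII.2.
* [BurungaleCastellaSkinner2025] A. Burungale, F. Castella, C. Skinner, *Base change and Iwasawa
  Main Conjectures for GL₂*, IMRN 2025 = arXiv:2405.00270, Thm. 1.1.2 (hypothesis (irr_ℚ)).
-/

noncomputable section

open scoped Classical

namespace WeierstrassCurve

open Literature.NumberTheory.EllipticCurves
open Field (absoluteGaloisGroup)

variable (W : WeierstrassCurve ℚ) [W.IsElliptic]

/-! ## §1 An integer killing `E[p²]` is divisible by `p²` -/

/-- **`#E[n] = n²` in the form used here**: the geometric `n`-torsion of an elliptic curve over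
`ℚ` has `n²` elements (`n ≠ 0`; Silverman *AEC* III.6.4(b), the tree's
`card_torsionPoints_eq_sq_holds`). [cite: SilvermanAEC2009, Cor. III.6.4(b)] -/
theorem natCard_geomTorsion_natCast {n : ℕ} (hn : n ≠ 0) :
    Nat.card (W.geomTorsion n) = n ^ 2 := by
  haveI : CharZero (AlgebraicClosure ℚ) :=
    charZero_of_injective_algebraMap (algebraMap ℚ (AlgebraicClosure ℚ)).injective
  exact card_torsionPoints_eq_sq_holds W (AlgebraicClosure ℚ) (Nat.cast_ne_zero.mpr hn)

/-- **An integer killing `E[p²]` is divisible by `p²`** (`p` prime).  Otherwise Bézout gives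
`aD + bp² = p`, so `p` kills `E[p²]`, i.e. `E[p²] ⊆ E[p]`, contradicting `#E[p²] = p⁴ > p² = #E[p]`
(Silverman *AEC* III.6.4(b)). [cite: SilvermanAEC2009, Cor. III.6.4(b)] -/
theorem sq_dvd_of_forall_zsmul_sq_eq_zero {p : ℕ} (hp : p.Prime) {D : ℤ}
    (hD : ∀ P : W.geomPoints, ((p : ℤ) ^ 2) • P = 0 → D • P = 0) : (p : ℤ) ^ 2 ∣ D := by
  by_contra hnd
  have hprime : Prime (p : ℤ) := Nat.prime_iff_prime_int.mp hp
  -- Bézout: `a D + b p² = p`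
  obtain ⟨a, b, hab⟩ : ∃ a b : ℤ, a * D + b * (p : ℤ) ^ 2 = p := by
    by_cases hpD : (p : ℤ) ∣ D
    · obtain ⟨D', rfl⟩ := hpD
      have hpD' : ¬ (p : ℤ) ∣ D' := fun h ↦ hnd (by rw [pow_two]; exact mul_dvd_mul_left _ h)
      obtain ⟨a, b, hab⟩ := (Prime.coprime_iff_not_dvd hprime).mpr hpD'
      exact ⟨b, a, by linear_combination (p : ℤ) * hab⟩
    · obtain ⟨a, b, hab⟩ := (Prime.coprime_iff_not_dvd hprime).mpr hpD
      exact ⟨b * p, a, by linear_combination (p : ℤ) * hab⟩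
  -- so `p` kills `E[p²]`: `E[p²] ⊆ E[p]`
  have hkill : ∀ P : W.geomPoints, ((p : ℤ) ^ 2) • P = 0 → (p : ℤ) • P = 0 := fun P hP ↦ by
    calc (p : ℤ) • P = (a * D + b * (p : ℤ) ^ 2) • P := by rw [hab]
      _ = 0 := by rw [add_zsmul, mul_zsmul, mul_zsmul, hD P hP, hP, zsmul_zero, zsmul_zero,
            add_zero]
  have hle : W.geomTorsion ((p ^ 2 : ℕ) : ℤ) ≤ W.geomTorsion p := fun P hP ↦ by
    rw [Submodule.mem_toAddSubgroup, Submodule.mem_torsionBy_iff] at hP ⊢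
    exact hkill P (by rw [← hP]; push_cast; rfl)
  -- compare cardinalities
  have h1 : Nat.card (W.geomTorsion ((p ^ 2 : ℕ) : ℤ)) = (p ^ 2) ^ 2 :=
    W.natCard_geomTorsion_natCast (pow_ne_zero 2 hp.ne_zero)
  have h2 : Nat.card (W.geomTorsion p) = p ^ 2 := W.natCard_geomTorsion_natCast hp.ne_zero
  haveI : Finite (W.geomTorsion p) :=
    Nat.finite_of_card_ne_zero (by rw [h2]; exact pow_ne_zero 2 hp.ne_zero)
  have hcard := Nat.card_le_card_of_injective _ (AddSubgroup.inclusion_injective hle)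
  rw [h1, h2] at hcard
  have hp2 : 2 ≤ p := hp.two_le
  have : p ^ 2 < (p ^ 2) ^ 2 := by
    have h4 : 4 ≤ p ^ 2 := by nlinarith
    nlinarith
  omega

/-! ## §2 Dividing a twisted `√D` by `p` while it vanishes on `E[p]` -/

/-- **One descent step.**  Let `ψ` be an additive endomorphism of `E(ℚ̄)` with `ψ ∘ ψ = D`,
twisted by `χ : Γ_ℚ → {±1}` (`ψ(σP) = χ(σ)·σψ(P)`), and suppose `ψ` vanishes on `E[p]`.  Then
`ψ = ψ₁ ∘ [p]` for an additive `ψ₁` (the factorisation through the surjection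
`[p] : E(ℚ̄) → E(ℚ̄)`, Silverman *AEC* §VIII.2), `ψ₁` is twisted by the same `χ`, `p² ∣ D`, and
`ψ₁ ∘ ψ₁ = D / p²`. [cite: SilvermanAEC2009, §VIII.2 (sequence 0 → E[m] → E(K̄) → E(K̄) → 0)] -/
theorem exists_sqrt_twist_div_of_forall_apply_eq_zero {ψ : AddMonoid.End W.geomPoints} {D : ℤ}
    (hψψ : ∀ P : W.geomPoints, ψ (ψ P) = D • P) {χ : absoluteGaloisGroup ℚ →* ℤˣ}
    (hrel : ∀ (σ : absoluteGaloisGroup ℚ) (P : W.geomPoints), ψ (σ • P) = ((χ σ : ℤˣ) : ℤ) • σ • ψ P)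
    {p : ℕ} (hp : p.Prime) (hker : ∀ P : W.geomPoints, (p : ℤ) • P = 0 → ψ P = 0) :
    ∃ (ψ₁ : AddMonoid.End W.geomPoints) (D₁ : ℤ), D = (p : ℤ) ^ 2 * D₁ ∧
      (∀ P : W.geomPoints, ψ₁ ((p : ℤ) • P) = ψ P) ∧
      (∀ P : W.geomPoints, ψ₁ (ψ₁ P) = D₁ • P) ∧
      (∀ (σ : absoluteGaloisGroup ℚ) (P : W.geomPoints),
        ψ₁ (σ • P) = ((χ σ : ℤˣ) : ℤ) • σ • ψ₁ P) := by
  have hp0 : (p : ℤ) ≠ 0 := Nat.cast_ne_zero.mpr hp.ne_zero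
  -- the surjection `[p]`
  set m : W.geomPoints →+ W.geomPoints := zsmulAddGroupHom (p : ℤ) with hm
  have hmapply : ∀ P : W.geomPoints, m P = (p : ℤ) • P := fun P ↦ rfl
  have hmsurj : Function.Surjective m := fun Q ↦ by
    obtain ⟨P, hP⟩ := W.zsmul_geomPoints_surjective_holds hp0 Q
    exact ⟨P, hP⟩
  have hle : m.ker ≤ (ψ : W.geomPoints →+ W.geomPoints).ker := fun P hP ↦ by
    rw [AddMonoidHom.mem_ker] at hP ⊢
    exact hker P hP
  -- the factorisation `ψ = ψ₁ ∘ [p]`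
  set ψ₁ : W.geomPoints →+ W.geomPoints := m.liftOfSurjective hmsurj ⟨ψ, hle⟩ with hψ₁
  have hfac : ∀ P : W.geomPoints, ψ₁ ((p : ℤ) • P) = ψ P := fun P ↦ by
    rw [← hmapply]
    exact m.liftOfRightInverse_comp_apply _ _ ⟨ψ, hle⟩ P
  -- `D` kills `E[p²]`, so `p² ∣ D`
  have hDkill : ∀ P : W.geomPoints, ((p : ℤ) ^ 2) • P = 0 → D • P = 0 := fun P hP ↦ by
    rw [← hψψ, ← hfac, ← map_zsmul ψ, ← hfac, smul_smul, ← pow_two, hP, map_zero, map_zero]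
  obtain ⟨D₁, hD₁⟩ := W.sq_dvd_of_forall_zsmul_sq_eq_zero hp hDkill
  refine ⟨ψ₁, D₁, hD₁, hfac, fun Q ↦ ?_, fun σ Q ↦ ?_⟩
  · -- `ψ₁² = D₁`: write `Q = p • (p • P)`
    obtain ⟨P₁, rfl⟩ := W.zsmul_geomPoints_surjective_holds hp0 Q
    obtain ⟨P, rfl⟩ := W.zsmul_geomPoints_surjective_holds hp0 P₁
    change ψ₁ (ψ₁ ((p : ℤ) • (p : ℤ) • P)) = D₁ • (p : ℤ) • (p : ℤ) • P
    rw [hfac, map_zsmul ψ, hfac, hψψ, hD₁, smul_smul, smul_smul]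
    congr 1
    ring
  · -- the twist
    obtain ⟨P, rfl⟩ := W.zsmul_geomPoints_surjective_holds hp0 Q
    change ψ₁ (σ • (p : ℤ) • P) = ((χ σ : ℤˣ) : ℤ) • σ • ψ₁ ((p : ℤ) • P)
    rw [smul_comm σ (p : ℤ) P, hfac, hfac, hrel]

/-- **A twisted `√D` which is visible on `E[p]`.**  For an elliptic curve `W/ℚ` with complex
multiplication and a prime `p` there are an additive endomorphism `ψ` of `E(ℚ̄)`, an integer
`D < 0` and a non-trivial character `χ : Γ_ℚ →* ℤˣ` with `ψ ∘ ψ = D`,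
`ψ(σ • P) = χ(σ) • σ • ψ(P)`, and `ψ(P₀) ≠ 0` for some `P₀ ∈ E[p]`.  Start from Lang's Remark
(`exists_sq_eq_intCast_quadraticTwist_of_hasCM`: a genuine CM endomorphism `√D` and its quadratic
character) and apply the descent step `exists_sqrt_twist_div_of_forall_apply_eq_zero` as long as
`ψ` vanishes on `E[p]`; `|D|` strictly decreases. [cite: Lang1987, Ch. 10 §4, Remark]
[cite: SilvermanAEC2009, §VIII.2 (sequence 0 → E[m] → E(K̄) → E(K̄) → 0)] -/
theorem exists_sqrt_twist_apply_ne_zero_of_hasCM (h : W.HasCM) {p : ℕ} (hp : p.Prime) :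
    ∃ (ψ : AddMonoid.End W.geomPoints) (D : ℤ) (χ : absoluteGaloisGroup ℚ →* ℤˣ),
      D < 0 ∧ (∀ P : W.geomPoints, ψ (ψ P) = D • P) ∧
      (∃ σ : absoluteGaloisGroup ℚ, χ σ ≠ 1) ∧
      (∀ (σ : absoluteGaloisGroup ℚ) (P : W.geomPoints), ψ (σ • P) = ((χ σ : ℤˣ) : ℤ) • σ • ψ P) ∧
      ∃ P₀ : W.geomPoints, (p : ℤ) • P₀ = 0 ∧ ψ P₀ ≠ 0 := by
  obtain ⟨ψ, -, D, χ, hD, hψψ, hne, hrel⟩ := W.exists_sq_eq_intCast_quadraticTwist_of_hasCM h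
  have hψψP : ∀ P : W.geomPoints, ψ (ψ P) = D • P := fun P ↦ by
    have := congrArg (fun f : AddMonoid.End W.geomPoints ↦ f P) hψψ
    simpa only [AddMonoid.End.coe_mul, Function.comp_apply, AddMonoid.End.intCast_apply] using this
  -- descent on `|D|`, the character `χ` being fixed
  suffices key : ∀ (n : ℕ) (D : ℤ) (ψ : AddMonoid.End W.geomPoints), D.natAbs = n → D < 0 →
      (∀ P : W.geomPoints, ψ (ψ P) = D • P) →
      (∀ (σ : absoluteGaloisGroup ℚ) (P : W.geomPoints),
        ψ (σ • P) = ((χ σ : ℤˣ) : ℤ) • σ • ψ P) →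
      ∃ (ψ' : AddMonoid.End W.geomPoints) (D' : ℤ), D' < 0 ∧
        (∀ P : W.geomPoints, ψ' (ψ' P) = D' • P) ∧
        (∀ (σ : absoluteGaloisGroup ℚ) (P : W.geomPoints),
          ψ' (σ • P) = ((χ σ : ℤˣ) : ℤ) • σ • ψ' P) ∧
        ∃ P₀ : W.geomPoints, (p : ℤ) • P₀ = 0 ∧ ψ' P₀ ≠ 0 by
    obtain ⟨ψ', D', hD', hψ'ψ', hrel', hP₀⟩ := key _ D ψ rfl hD hψψP hrel
    exact ⟨ψ', D', χ, hD', hψ'ψ', hne, hrel', hP₀⟩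
  intro n
  induction n using Nat.strong_induction_on with
  | _ n ih =>
    intro D ψ hn hD hψψ hrel
    by_cases hvis : ∃ P₀ : W.geomPoints, (p : ℤ) • P₀ = 0 ∧ ψ P₀ ≠ 0
    · exact ⟨ψ, D, hD, hψψ, hrel, hvis⟩
    · push Not at hvis
      obtain ⟨ψ₁, D₁, hDD₁, -, hψ₁ψ₁, hrel₁⟩ :=
        W.exists_sqrt_twist_div_of_forall_apply_eq_zero hψψ hrel hp hvis
      have hp1 : 1 < (p : ℤ) ^ 2 := by
        have h2 : (2 : ℤ) ≤ p := by exact_mod_cast hp.two_le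
        nlinarith
      have hD₁ : D₁ < 0 := by
        by_contra hge
        push Not at hge
        have : 0 ≤ (p : ℤ) ^ 2 * D₁ := mul_nonneg (by positivity) hge
        omega
      have hlt : D₁.natAbs < n := by
        rw [← hn, hDD₁, Int.natAbs_mul, Int.natAbs_pow]
        have h1 : 1 < (p : ℤ).natAbs ^ 2 := by
          rw [Int.natAbs_natCast]
          nlinarith [hp.two_le]
        have h2 : 0 < D₁.natAbs := Int.natAbs_pos.mpr hD₁.ne
        nlinarith
      exact ih _ hlt D₁ ψ₁ rfl hD₁ hψ₁ψ₁ hrel₁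


/-! ## §3 At a good ordinary prime `p > 3`, a visible twisted `√D` has `p ∤ D` -/

section Ordinary

open scoped NumberField
open IsDedekindDomain Rat.HeightOneSpectrum Literature.NumberTheory.GaloisRepresentations

/-- **`E[p]` is a plane over `𝔽_p`** (`#E[p] = p²`, Silverman *AEC* III.6.4(b)), for the
`ZMod p`-module structure `AddSubgroup.torsionBy.zmodModule`. [cite: SilvermanAEC2009, Cor. III.6.4(b)] -/
theorem finrank_zmod_geomTorsion_eq_two (p : ℕ) [Fact p.Prime] :
    letI : Module (ZMod p) (W.geomTorsion p) := AddSubgroup.torsionBy.zmodModule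
    Module.finrank (ZMod p) (W.geomTorsion p) = 2 := by
  letI : Module (ZMod p) (W.geomTorsion p) := AddSubgroup.torsionBy.zmodModule
  have hp : p.Prime := Fact.out
  have hcard : Nat.card (W.geomTorsion p) = p ^ 2 := W.natCard_geomTorsion_natCast hp.ne_zero
  haveI : Finite (W.geomTorsion p) :=
    Nat.finite_of_card_ne_zero (by rw [hcard]; exact pow_ne_zero 2 hp.ne_zero)
  haveI : Module.Finite (ZMod p) (W.geomTorsion p) := Module.Finite.of_finite
  have h := Module.natCard_eq_pow_finrank (K := ZMod p) (V := W.geomTorsion p)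
  rw [hcard, Nat.card_zmod] at h
  exact (Nat.pow_right_injective hp.two_le h).symm

variable [W.IsGloballyMinimal]

/-- **Deuring's "ramified primes are supersingular", read on `E[p]`.**  Let `E = W/ℚ` be elliptic
in global minimal form, `p > 3` a prime with `p ∤ Δ_E` and `p ∤ a_p` (good ordinary reduction),
and `φ` an endomorphism of `E[p]` with `φ ∘ φ = D`, twisted by a character `χ : Γ_ℚ → {±1}`
(`φ(σP) = χ(σ)·σφ(P)`) and `φ ≠ 0`.  Then `p ∤ D`.  For if `p ∣ D` then `φ² = 0`, `φ ≠ 0`; by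
Serre, §1.11 Prop. 11 and Cor. (tree: `exists_line_of_not_dvd_frobeniusTrace`,
`exists_mem_inertia_smul_eq_of_sub_mem_line`) the inertia group at `p` contains `τ` with
`τ x - x ∈ 𝔽_p v₀` for all `x` and `τ v₀ = 2 v₀`; as `2 ≠ 0, ±1` in `𝔽_p`, a `τ`-eigenvector has
eigenvalue `1`, or eigenvalue `2` and lies on `𝔽_p v₀`; the relation `φτ = ±τφ` then gives
`φ v₀ = 0` (it would be an eigenvector of eigenvalue `±2`) and `φ w = 0` for each `τ`-fixed `w`
(`φ w` is an eigenvector of eigenvalue `±1` killed by `φ`, and together with `v₀` it would span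
`E[p]`), whence `φ = 0` since `E[p] = (E[p])^τ + 𝔽_p v₀`.  (For a CM curve this says that a prime
of good ordinary reduction does not divide the discriminant of a CM endomorphism visible on
`E[p]`, i.e. is unramified in the CM field: Deuring; Lang, *Elliptic Functions*, Ch. 13 §4
Thm. 12.) [cite: Serre1972, §1.11 Prop. 11 and Cor.] [cite: Lang1987, Ch. 13 §4, Thm. 12] -/
theorem not_dvd_of_sqrt_twist_of_not_dvd_frobeniusTrace (p : ℕ) [Fact p.Prime] (hp3 : 3 < p)
    (hΔ : ¬ (p : ℤ) ∣ minimalDiscriminantInt W) (hord : ¬ (p : ℤ) ∣ W.frobeniusTrace p)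
    {φ : AddMonoid.End (W.geomTorsion p)} {D : ℤ} {χ : absoluteGaloisGroup ℚ →* ℤˣ}
    (hφ : ∀ P : W.geomTorsion p, φ (φ P) = D • P)
    (htw : ∀ (σ : absoluteGaloisGroup ℚ) (P : W.geomTorsion p),
      φ (σ • P) = ((χ σ : ℤˣ) : ℤ) • σ • φ P)
    (hφ0 : ∃ P : W.geomTorsion p, φ P ≠ 0) : ¬ (p : ℤ) ∣ D := by
  intro hpD
  letI : Module (ZMod p) (W.geomTorsion p) := AddSubgroup.torsionBy.zmodModule
  have hp : p.Prime := Fact.out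
  haveI : NeZero p := ⟨hp.ne_zero⟩
  -- `φ² = 0` on `E[p]`
  have hφφ : ∀ P : W.geomTorsion p, φ (φ P) = 0 := fun P ↦ by
    obtain ⟨k, hk⟩ := hpD
    rw [hφ, hk, mul_comm, mul_zsmul, natCast_zsmul, AddSubgroup.torsionBy.nsmul, zsmul_zero]
  -- scalars: `2 ≠ 0`, `2 ≠ 1`, `2 ≠ -1` in `𝔽_p` (`p > 3`)
  have hnat : ∀ n : ℕ, 0 < n → n < p → ((n : ℕ) : ZMod p) ≠ 0 := fun n hn hnp h ↦ by
    rw [ZMod.natCast_eq_zero_iff] at h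
    exact absurd (Nat.le_of_dvd hn h) (not_le.mpr hnp)
  have h20 : (2 : ZMod p) ≠ 0 := by exact_mod_cast hnat 2 two_pos (by omega)
  have h21 : (2 : ZMod p) ≠ 1 := fun h ↦
    hnat 1 one_pos hp.one_lt (by rw [Nat.cast_one]; linear_combination h)
  have h2m1 : (2 : ZMod p) ≠ -1 := fun h ↦
    hnat 3 three_pos hp3 (by rw [Nat.cast_ofNat]; linear_combination h)
  -- linearity of `φ` and of the Galois action over `𝔽_p`
  have hφlin : ∀ (c : ZMod p) (x : W.geomTorsion p), φ (c • x) = c • φ x :=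
    fun c x ↦ ZMod.map_smul φ c x
  have hσlin : ∀ (σ : absoluteGaloisGroup ℚ) (c : ZMod p) (x : W.geomTorsion p),
      σ • c • x = c • σ • x :=
    fun σ c x ↦ ZMod.map_smul (DistribSMul.toAddMonoidHom (W.geomTorsion p) σ) c x
  -- the inertia element `τ`: `τ x - x ∈ 𝔽_p v₀`, `τ v₀ = 2 v₀`
  obtain ⟨v, hv⟩ : ∃ v : HeightOneSpectrum (𝓞 ℚ), (primesEquiv v : ℕ) = p :=
    ⟨primesEquiv.symm ⟨p, hp⟩, by rw [Equiv.apply_symm_apply]⟩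
  obtain ⟨𝔓, hmem, h𝔓⟩ := exists_ideal_placeOver p hv
  obtain ⟨v₀, hv₀, hline⟩ := exists_line_of_not_dvd_frobeniusTrace p hΔ hord hmem
  obtain ⟨τ, hτ, hτv₀⟩ :=
    W.exists_mem_inertia_smul_eq_of_sub_mem_line p hv h𝔓 hv₀ hline (Units.mk0 (2 : ZMod p) h20)
  rw [Units.val_mk0] at hτv₀
  -- the sign `e = χ(τ) = ±1`
  set e : ZMod p := (((χ τ : ℤˣ) : ℤ) : ZMod p) with he_def
  have he : ∀ P : W.geomTorsion p, φ (τ • P) = e • τ • φ P := fun P ↦ by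
    rw [htw, he_def, Int.cast_smul_eq_zsmul]
  have he1 : e = 1 ∨ e = -1 := by
    rcases Int.units_eq_one_or (χ τ) with h | h
    · left; rw [he_def, h, Units.val_one, Int.cast_one]
    · right; rw [he_def, h, Units.val_neg, Units.val_one, Int.cast_neg, Int.cast_one]
  have hee : e * e = 1 := by rcases he1 with h | h <;> rw [h] <;> ring
  have he' : ∀ P : W.geomTorsion p, τ • φ P = e • φ (τ • P) := fun P ↦ by
    rw [he, smul_smul, hee, one_smul]
  -- (i) eigenvalues of `τ`: `1`, or `2` on the line `𝔽_p v₀`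
  have heig : ∀ (x : W.geomTorsion p) (μ : ZMod p), x ≠ 0 → τ • x = μ • x →
      μ = 1 ∨ (μ = 2 ∧ ∃ c : ZMod p, x = c • v₀) := by
    intro x μ hx hμx
    by_cases hμ : μ = 1
    · exact Or.inl hμ
    · right
      obtain ⟨b, hb⟩ := hline τ hτ x
      have hμ1 : μ - 1 ≠ 0 := sub_ne_zero.mpr hμ
      have hx1 : (μ - 1) • x = b • v₀ := by rw [sub_smul, one_smul, ← hμx, hb]
      have hxc : x = ((μ - 1)⁻¹ * b) • v₀ := by
        rw [mul_smul, ← hx1, smul_smul, inv_mul_cancel₀ hμ1, one_smul]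
      refine ⟨?_, _, hxc⟩
      have h2x : τ • x = (2 : ZMod p) • x := by
        rw [hxc, hσlin, hτv₀, smul_smul, smul_smul, mul_comm (2 : ZMod p)]
      have : (μ - 2) • x = 0 := by rw [sub_smul, ← hμx, ← h2x, sub_self]
      exact sub_eq_zero.mp ((smul_eq_zero.mp this).resolve_right hx)
  -- (ii) `φ v₀ = 0`
  have hφv₀ : φ v₀ = 0 := by
    by_contra hne
    have hτy : τ • φ v₀ = (e * 2) • φ v₀ := by rw [he', hτv₀, hφlin, smul_smul]
    rcases heig _ _ hne hτy with h | ⟨h, c, hc⟩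
    · rcases he1 with h1 | h1
      · rw [h1, one_mul] at h; exact h21 h
      · rw [h1, neg_one_mul, neg_eq_iff_eq_neg] at h; exact h2m1 h
    · have hcc : (c * c) • v₀ = 0 := by rw [mul_smul, ← hc, ← hφlin, ← hc, hφφ]
      have hc0 : c = 0 := by
        have := (smul_eq_zero.mp hcc).resolve_right hv₀
        exact mul_self_eq_zero.mp this
      rw [hc0, zero_smul] at hc
      exact hne hc
  -- (iii) `φ w = 0` for every `τ`-fixed `w`
  have hfix : ∀ w : W.geomTorsion p, τ • w = w → φ w = 0 := by
    intro w hw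
    by_contra hz
    have hτz : τ • φ w = e • φ w := by rw [he', hw]
    rcases heig _ _ hz hτz with h1 | ⟨h2, -⟩
    · -- `τ` fixes `z = φ w`; `z` and `v₀` are independent and both killed by `φ`, so `φ = 0`
      rw [h1, one_smul] at hτz
      have hli : LinearIndependent (ZMod p) ![φ w, v₀] := by
        rw [LinearIndependent.pair_iff]
        intro s t hst
        have h1' : s • φ w + (t * 2) • v₀ = 0 := by
          have := congrArg (fun y : W.geomTorsion p ↦ τ • y) hst
          simpa only [smul_add, smul_zero, hσlin, hτz, hτv₀, smul_smul] using this
        have ht : t • v₀ = 0 := by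
          have h3 := sub_eq_zero.mpr (h1'.trans hst.symm)
          rwa [add_sub_add_left_eq_sub, ← sub_smul, mul_two, add_sub_cancel_right] at h3
        have ht0 : t = 0 := (smul_eq_zero.mp ht).resolve_right hv₀
        rw [ht0, zero_smul, add_zero] at hst
        exact ⟨(smul_eq_zero.mp hst).resolve_right hz, ht0⟩
      have hspan : Submodule.span (ZMod p) (Set.range ![φ w, v₀]) = ⊤ :=
        hli.span_eq_top_of_card_eq_finrank (by rw [W.finrank_zmod_geomTorsion_eq_two p]; rfl)
      obtain ⟨P₀, hP₀⟩ := hφ0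
      apply hP₀
      have hmemP : P₀ ∈ Submodule.span (ZMod p) (Set.range ![φ w, v₀]) := by
        rw [hspan]; exact Submodule.mem_top
      rw [Matrix.range_cons, Matrix.range_cons, Matrix.range_empty, Set.union_empty,
        Set.union_singleton, Set.pair_comm, Submodule.mem_span_pair] at hmemP
      obtain ⟨s, t, rfl⟩ := hmemP
      rw [map_add, hφlin, hφlin, hφφ, hφv₀, smul_zero, smul_zero, add_zero]
    · rcases he1 with h1 | h1
      · exact h21 (h2.symm.trans h1)
      · exact h2m1 (h2.symm.trans h1)
  -- (iv) hence `φ = 0`: every `x` is `w + b v₀` with `τ w = w`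
  obtain ⟨P₀, hP₀⟩ := hφ0
  apply hP₀
  obtain ⟨b, hb⟩ := hline τ hτ P₀
  have hw : τ • (P₀ - b • v₀) = P₀ - b • v₀ := by
    rw [smul_sub, hσlin, hτv₀, smul_smul]
    have : τ • P₀ = P₀ + b • v₀ := by rw [← hb, add_sub_cancel]
    rw [this, add_sub_assoc, ← sub_smul, sub_eq_add_neg P₀ (b • v₀), ← neg_smul]
    congr 2
    ring
  have := hfix _ hw
  rwa [map_sub, hφlin, hφv₀, smul_zero, sub_zero] at this

end Ordinary

/-! ## §4 `p ∤ D`: a `Γ_ℚ`-stable line would be an eigenline of `√D` -/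

section Irreducible

variable [W.IsGloballyMinimal]

/-- **Irreducibility of `E[p]` from a twisted `√D` with `p ∤ D`** (Serre 1972, §4.5: the image
of `Γ_ℚ` normalises the Cartan subgroup `(O/p)ˣ ⊇ ρ̄(Γ_K)` and is not contained in it; Zywina
2015, §1.9).
Let `E = W/ℚ` be elliptic in global minimal form, `p > 3` a prime with `p ∤ Δ_E`, and `φ` an
endomorphism of `E[p]` with `φ ∘ φ = D`, `p ∤ D`, twisted by a NON-TRIVIAL `χ : Γ_ℚ → {±1}`.
Then `E[p]` is an irreducible `Γ_ℚ`-module.  Proof: by the Cartan theorem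
`exists_smul_eq_add_mul_of_not_dvd_minimalDiscriminantInt` (Lang, Ch. 10 §4, Thm. 8) some
`σ ∈ ker χ` acts on `E[p]` as `φ`, so a stable line `L = 𝔽_p P₁` is `φ`-stable: `φ P₁ = λ P₁`,
`λ² ≡ D`.  For `σ₀` with `χ(σ₀) = -1`, `σ₀ P₁ = μ P₁` with `p ∤ μ`, and
`μλ P₁ = φ(σ₀ P₁) = -σ₀ φ(P₁) = -λμ P₁`, so `p ∣ 2λμ`, `p ∣ λ`, `p ∣ D` — a contradiction.
[cite: Serre1972, §4.5] [cite: Zywina2015, §1.9 (Prop. 1.14, Prop. 1.16)]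
[cite: Lang1987, Ch. 10 §4, Thm. 8] -/
theorem hasIrreducibleModPGaloisRep_of_sqrt_twist (p : ℕ) [Fact p.Prime] (hp3 : 3 < p)
    (hΔ : ¬ (p : ℤ) ∣ minimalDiscriminantInt W)
    {φ : AddMonoid.End (W.geomTorsion p)} {D : ℤ} {χ : absoluteGaloisGroup ℚ →* ℤˣ}
    (hφ : ∀ P : W.geomTorsion p, φ (φ P) = D • P) (hpD : ¬ (p : ℤ) ∣ D)
    (hχ : ∃ σ : absoluteGaloisGroup ℚ, χ σ ≠ 1)
    (htw : ∀ (σ : absoluteGaloisGroup ℚ) (P : W.geomTorsion p),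
      φ (σ • P) = ((χ σ : ℤˣ) : ℤ) • σ • φ P) :
    W.HasIrreducibleModPGaloisRep p := by
  have hp : p.Prime := Fact.out
  have hprime : Prime (p : ℤ) := Nat.prime_iff_prime_int.mp hp
  intro H hH
  -- some `σ ∈ Γ_K` acts on `E[p]` exactly as `φ`, so `H` is `φ`-stable
  obtain ⟨σ, -, hσ⟩ := exists_smul_eq_add_mul_of_not_dvd_minimalDiscriminantInt W p hp3 hΔ hφ hpD
    hχ htw 0 1 (by simpa using hpD)
  have hσφ : ∀ P : W.geomTorsion p, σ • P = φ P := fun P ↦ by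
    rw [hσ P, Int.cast_zero, Int.cast_one, zero_add, one_mul]
  have hHφ : ∀ P ∈ H, φ P ∈ H := fun P hP ↦ by rw [← hσφ]; exact hH σ P hP
  by_contra hne
  push Not at hne
  obtain ⟨hbot, htop⟩ := hne
  -- `H` has order `p`, generated by any `P₁ ≠ 0`
  have hcardE : Nat.card (W.geomTorsion p) = p ^ 2 := W.natCard_geomTorsion_natCast hp.ne_zero
  haveI : Finite (W.geomTorsion p) :=
    Nat.finite_of_card_ne_zero (by rw [hcardE]; exact pow_ne_zero 2 hp.ne_zero)
  have hdvd : Nat.card H ∣ p ^ 2 := hcardE ▸ H.card_addSubgroup_dvd_card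
  obtain ⟨k, hk, hcardH⟩ := (Nat.dvd_prime_pow hp).mp hdvd
  have hk1 : k = 1 := by
    interval_cases k
    · exact absurd (AddSubgroup.eq_bot_of_card_eq H (by rw [hcardH, pow_zero])) hbot
    · rfl
    · exact absurd (AddSubgroup.eq_top_of_card_eq H (by rw [hcardH, hcardE])) htop
  rw [hk1, pow_one] at hcardH
  obtain ⟨P₁, hP₁H, hP₁⟩ : ∃ P₁ ∈ H, P₁ ≠ 0 := by
    by_contra h
    push Not at h
    exact hbot ((AddSubgroup.eq_bot_iff_forall _).mpr h)
  have hgen : ∀ Q ∈ H, ∃ k : ℤ, Q = k • P₁ := fun Q hQ ↦ by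
    have hne1 : (⟨P₁, hP₁H⟩ : H) ≠ 0 := fun h ↦ hP₁ (congrArg Subtype.val h)
    obtain ⟨k, hk⟩ := AddSubgroup.mem_zmultiples_iff.mp
      (mem_zmultiples_of_prime_card hcardH (g' := (⟨Q, hQ⟩ : H)) hne1)
    exact ⟨k, by simpa using (congrArg Subtype.val hk).symm⟩
  -- `φ P₁ = l P₁` with `l² ≡ D`, and `σ₀ P₁ = m P₁` for `χ(σ₀) = -1`
  obtain ⟨l, hl⟩ := hgen _ (hHφ P₁ hP₁H)
  obtain ⟨σ₀, hσ₀⟩ := hχ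
  have hσ₀' : χ σ₀ = -1 := (Int.units_eq_one_or _).resolve_left hσ₀
  obtain ⟨m, hm⟩ := hgen _ (hH σ₀ P₁ hP₁H)
  have hll : (l * l - D) • P₁ = 0 := by
    have : φ (φ P₁) = (l * l) • P₁ := by rw [hl, map_zsmul, hl, smul_smul]
    rw [sub_zsmul, ← this, hφ]
    abel
  have h2 : (2 * (l * m)) • P₁ = 0 := by
    have ha : φ (σ₀ • P₁) = (m * l) • P₁ := by rw [hm, map_zsmul, hl, smul_smul]
    have hb : φ (σ₀ • P₁) = -((l * m) • P₁) := by
      rw [htw, hσ₀', Units.val_neg, Units.val_one, neg_one_zsmul, hl, smul_comm σ₀ l P₁, hm,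
        smul_smul]
    have h := ha.symm.trans hb
    rw [eq_neg_iff_add_eq_zero, ← add_zsmul] at h
    convert h using 2
    ring
  -- `p ∤ m` (else `σ₀ P₁ = 0`), so `p ∣ l` and `p ∣ D`
  have hpm : ¬ (p : ℤ) ∣ m := fun ⟨n, hn⟩ ↦ hP₁ <| (smul_eq_zero_iff_eq σ₀).mp <| by
    rw [hm, hn, mul_comm, mul_zsmul, natCast_zsmul, AddSubgroup.torsionBy.nsmul, zsmul_zero]
  have hpl : (p : ℤ) ∣ l := by
    have h2' : (p : ℤ) ∣ 2 * (l * m) := by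
      by_contra hnd
      exact hP₁ (W.geomTorsion_eq_zero_of_zsmul_eq_zero hp hnd P₁ h2)
    rcases hprime.dvd_or_dvd h2' with h | h
    · have h2p : p ∣ 2 := by exact_mod_cast h
      exact absurd (Nat.le_of_dvd two_pos h2p) (by omega)
    · exact (hprime.dvd_or_dvd h).resolve_right hpm
  apply hpD
  have hll' : (p : ℤ) ∣ l * l - D := by
    by_contra hnd
    exact hP₁ (W.geomTorsion_eq_zero_of_zsmul_eq_zero hp hnd P₁ hll)
  have := dvd_sub (dvd_mul_of_dvd_left hpl l) hll'
  rwa [sub_sub_cancel] at this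

/-! ## §5 Assembly -/

/-- **`E[p]` is irreducible for a CM elliptic curve over `ℚ` at a good ordinary prime `p > 3`.**
Let `E = W/ℚ` be an elliptic curve in global minimal form with complex multiplication, and
`p > 3` a prime of good reduction with `p ∤ a_p(E)`.  Then the mod-`p` Galois representation
`ρ̄_{E,p} : Γ_ℚ → Aut(E[p])` is irreducible (the only `Γ_ℚ`-stable subgroups of `E[p]` are `0` and
`E[p]`).  Serre, *Invent. Math.* 15 (1972), §4.5 (over the CM field `K` the image of `Γ_K` is
the Cartan subgroup `(O/p)ˣ` for almost all `p`, and `Γ_ℚ` maps to its normaliser) with §1.11;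
Zywina, arXiv:1508.07660, §1.9 (Prop. 1.14, Prop. 1.16: the list of images over `ℚ`).  A line
stable under the Cartan subgroup is an eigenline of `√D` and complex conjugation swaps the two
eigenlines, whence irreducibility as soon as `p ∤ D`; at an ordinary prime `p` is split in the
CM field, and the ordinary hypothesis is what guarantees `p ∤ D` here (§3) — it is needed: at the
primes ramified in the CM field `E[p]` is reducible.  This discharges, for CM curves, the
hypothesis `(irr_ℚ)` of Burungale–Castella–Skinner 2025, Thm. 1.1.2 (Mazur's main conjecture) in
the good-ordinary slice of Burungale–Tian's rank-zero `p`-converse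
(`BSDSelmerPConverseRankZeroProofs`).
[cite: Serre1972, §4.5 and §1.11] [cite: Zywina2015, §1.9 (Prop. 1.14, Prop. 1.16)] -/
theorem hasIrreducibleModPGaloisRep_of_hasCM_of_not_dvd_frobeniusTrace (hCM : W.HasCM) (p : ℕ)
    [Fact p.Prime] (hp3 : 3 < p) (hgood : W.HasGoodReductionAtPrime p)
    (hord : ¬ (p : ℤ) ∣ W.frobeniusTrace p) : W.HasIrreducibleModPGaloisRep p := by
  have hp : p.Prime := Fact.out
  have hΔ := W.not_dvd_minimalDiscriminantInt_of_hasGoodReductionAtPrime' p hgood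
  -- a twisted `√D` visible on `E[p]`
  obtain ⟨ψ, D, χ, -, hψψ, hχ, hrel, P₀, hP₀p, hP₀⟩ :=
    W.exists_sqrt_twist_apply_ne_zero_of_hasCM hCM hp
  have hψψ' : ψ * ψ = (D : AddMonoid.End W.geomPoints) := by
    refine AddMonoidHom.ext fun P ↦ ?_
    change ψ (ψ P) = (D : AddMonoid.End W.geomPoints) P
    rw [AddMonoid.End.intCast_apply]
    exact hψψ P
  -- its restriction `φ` to `E[p]` is non-zero
  obtain ⟨φ, hφcoe, hφφ, hφrel⟩ := exists_restrict_geomTorsion_of_twist W hψψ' hrel p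
  have hP₀mem : P₀ ∈ W.geomTorsion p := by
    rwa [Submodule.mem_toAddSubgroup, Submodule.mem_torsionBy_iff]
  have hφ0 : ∃ P : W.geomTorsion p, φ P ≠ 0 :=
    ⟨⟨P₀, hP₀mem⟩, fun h ↦ hP₀ (by rw [← hφcoe ⟨P₀, hP₀mem⟩, h]; rfl)⟩
  -- §3: `p ∤ D`; §4: irreducible
  have hpD := W.not_dvd_of_sqrt_twist_of_not_dvd_frobeniusTrace p hp3 hΔ hord hφφ hφrel hφ0
  exact W.hasIrreducibleModPGaloisRep_of_sqrt_twist p hp3 hΔ hφφ hpD hχ hφrel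

/-- **The same at `p ≥ 5`**, the form consumed by the good-ordinary slice of the `p`-converse
theorems (`5 ≤ p`). [cite: Serre1972, §4.5 and §1.11] -/
theorem hasIrreducibleModPGaloisRep_of_hasCM_of_five_le (hCM : W.HasCM) (p : ℕ) [Fact p.Prime]
    (hp : 5 ≤ p) (hgood : W.HasGoodReductionAtPrime p) (hord : ¬ (p : ℤ) ∣ W.frobeniusTrace p) :
    W.HasIrreducibleModPGaloisRep p :=
  W.hasIrreducibleModPGaloisRep_of_hasCM_of_not_dvd_frobeniusTrace hCM p (by omega) hgood hord

end Irreducible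

end WeierstrassCurve

end
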